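import Literature.Geometry.Riemannian.BamlerFCompactnessAssembly
import HarnessLib

/-!
# Bamler's 𝔽-compactness of Ricci flows from total boundedness (with compact time-slices) and
# completeness (Bamler 2023, §7.3, proof of Thm. 7.4; §7.1, Cor. 7.5 with Lemma 7.3)

R. Bamler, *Compactness theory of the space of super Ricci flows*, Invent. Math. 233 (2023), §7.1,
Theorem 7.4 (arXiv v1 Thm. 155): "Assume that `I ⊂ ℝ` is a finite interval and suppose that
`J ⊂ I` is a finite subset. Let `H, V ≥ 0`, `r > 0` and `b : (0,1] → (0,1]` be a function. Then
`𝔽^J_I(H, V, b, r)` is a compact subset of `(𝔽^J_I, d^J_𝔽)`", proof (§7.3): "… so by Theorem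
[completeness] it is complete. To see total boundedness, suppose by contradiction that there is a
sequence … with `d_𝔽(·,·) > ε r` for all `i ≠ j` … [Lemmas 164, 165]"; Corollary 7.5 (arXiv v1
Cor. 156) for super Ricci flows on compact manifolds with conjugate heat kernels, via Lemma 7.3.

This file is the variant of the assembly `bamler_FCompactness_ricciFlow_of_totallyBounded_of_complete`
(`BamlerFCompactnessAssembly.lean`) in which the TOTAL BOUNDEDNESS hypothesis is only required for
sequences of `H`-concentrated metric flow pairs over `[a, T]` all of whose time-slices are COMPACT
(the form proved in the tree from Bamler's §7.2–§7.3, where the mass-distribution bound `b` of the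
class `𝔽(H, V, b, r)` is produced from compactness of the slices): the pairs
`ricciFlowMetricFlowPair` of Ricci flows on closed manifolds have time-slices the compact manifold
`M` itself, so the weaker hypothesis still applies to them, and the proof is otherwise verbatim the
"complete + totally bounded ⇒ sequentially compact" diagonal argument of the cited proof.

* `bamler_FCompactness_ricciFlow_of_totallyBounded_compact_of_complete` — the assembly.

## References

* R. H. Bamler, *Compactness theory of the space of super Ricci flows*, Invent. Math. 233 (2023),
  1121–1277 (arXiv:2008.09298), §7.3, proof of Thm. 7.4 (arXiv v1 Thm. 155, Lemmas 164–166);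
  §7.1 Cor. 7.5, Lemma 7.3 (arXiv v1 Cor. 156, Lemma 154). [Bamler2023]
-/

noncomputable section

open Set MeasureTheory Filter TopologicalSpace Function
open scoped Topology ENNReal NNReal

namespace Literature.Geometry.Riemannian

/-- **Bamler's 𝔽-compactness of compact Ricci flows with conjugate heat kernels (Cor. 7.5 with
Thm. 7.4 and Lemma 7.3, `J = ∅`) from total boundedness for pairs with compact time-slices and
completeness.** Assume (TOTAL BOUNDEDNESS, §7.3) that every sequence of `H`-concentrated metric
flow pairs over `[a, T]` defined over `(a, T)` with `Var(μ_t) ≤ C` and compact time-slices has, for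
every `ε > 0`, a subsequence with all mutual `d_𝔽`-distances `≤ ε`, and (COMPLETENESS, §5.4 with
the closedness of `𝔽_I(H)`) that every sequence of `H`-concentrated pairs over `[a, T]` with
measurable exceptional sets and `d_𝔽(P_n, P_{n+1}) < 2^{-n}` has an `H`-concentrated `d_𝔽`-limit
with measurable exceptional set. Then `bamler_FCompactness_ricciFlow` holds: the pairs
`Q_k = (𝒳^k, (ν_{x_k,T;s})_{s ∈ (a,T)})` of Ricci flows on closed connected `m`-manifolds over
`[a, T]` are `H_m`-concentrated with `Var(ν_{x_k,T;s}) ≤ H_m (T − a)` (Lemma 7.3) and have the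
compact manifolds `M_k` as time-slices, so nested applications of total boundedness with
`ε = 2^{-(k+1)}` and a diagonal extraction (`exists_strictMono_lt_two_inv_pow_of_subseq`) give a
subsequence `σ` with `d_𝔽(Q_{σ k}, Q_{σ (k+1)}) < 2^{-k}`, which converges by completeness.
[cite: Bamler2023, §7.3, proof of Thm 7.4 (arXiv v1 Thm 155); §7.1 Cor 7.5, Lemma 7.3] -/
theorem bamler_FCompactness_ricciFlow_of_totallyBounded_compact_of_complete
    (hTB : ∀ (H C a T : ℝ), 0 ≤ H → a < T → ∀ P : ℕ → MetricFlowPair.{0} (Icc a T),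
      (∀ n, (P n).flow.IsHConcentrated H) → (∀ n, Ioo a T ⊆ (P n).I') →
      (∀ n (t : (P n).I'), variance ((P n).μ t) ((P n).μ t) ≤ ENNReal.ofReal C) →
      (∀ n (t : (P n).I'), CompactSpace ((P n).flow.Slice t)) →
      ∀ ε : ℝ≥0∞, 0 < ε → ∃ φ : ℕ → ℕ, StrictMono φ ∧
        ∀ i j, MetricFlowPair.fDist ∅ (P (φ i)) (P (φ j)) ≤ ε)
    (hCP : ∀ (H a T : ℝ), 0 ≤ H → a < T → ∀ P : ℕ → MetricFlowPair.{0} (Icc a T),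
      (∀ n, (P n).flow.IsHConcentrated H) → (∀ n, MeasurableSet (Icc a T \ (P n).I')) →
      (∀ n, MetricFlowPair.fDist ∅ (P n) (P (n + 1)) < 2⁻¹ ^ n) →
      ∃ Pinf : MetricFlowPair.{0} (Icc a T), Pinf.flow.IsHConcentrated H ∧
        MeasurableSet (Icc a T \ Pinf.I') ∧
        Tendsto (fun n ↦ MetricFlowPair.fDist ∅ (P n) Pinf) atTop (𝓝 0)) :
    bamler_FCompactness_ricciFlow := by
  intro m hm a T haT M _ _ _ _ _ _ _ _ _ h cov hflow hh hR x
  -- the pairs of the flows (Lemma 7.3): `H_m`-concentrated, `Var ≤ H_m (T - a)`, over `(a, T)`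
  set Q : ℕ → MetricFlowPair.{0} (Icc a T) := fun k ↦
    ricciFlowMetricFlowPair (hh k) (hR k) (hflow k) haT (x k) with hQ
  have hH : 0 ≤ MetricFlow.concentrationConst m := concentrationConst_nonneg hm
  have hQH : ∀ k, (Q k).flow.IsHConcentrated (MetricFlow.concentrationConst m) := fun k ↦
    ricciFlowMetricFlowPair_isHConcentrated hm (hflow k) (hh k) (hR k) haT (x k)
  have hQI : ∀ k, Ioo a T ⊆ (Q k).I' := fun _ ↦ Subset.rfl
  have hQV : ∀ (k) (t : (Q k).I'), variance ((Q k).μ t) ((Q k).μ t) ≤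
      ENNReal.ofReal (MetricFlow.concentrationConst m * (T - a)) := by
    intro k t
    have ht : (t : ℝ) ∈ Ioo a T := t.2
    exact (variance_ricciFlowMetricFlowPair_measure_le hm (hflow k) (hh k) (hR k) haT (x k) t).trans
      (ENNReal.ofReal_le_ofReal (mul_le_mul_of_nonneg_left (by linarith only [ht.1]) hH))
  -- the time-slices of the pairs are the compact manifolds `M k`
  have hQc : ∀ (k) (t : (Q k).I'), CompactSpace ((Q k).flow.Slice t) := fun k _ ↦
    inferInstanceAs (CompactSpace (M k))
  have hQM : ∀ k, MeasurableSet (Icc a T \ (Q k).I') := fun k ↦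
    measurableSet_Icc_diff_ricciFlowMetricFlowPair_I' (hh k) (hR k) (hflow k) haT (x k)
  -- Step 1 (total boundedness and the diagonal argument): `d_F(Q (σ k), Q (σ (k+1))) < 2^{-k}`
  obtain ⟨σ, hσ, hfast⟩ := exists_strictMono_lt_two_inv_pow_of_subseq
    (G := fun i j ↦ MetricFlowPair.fDist ∅ (Q i) (Q j)) fun ψ ε hε ↦
      hTB (MetricFlow.concentrationConst m) (MetricFlow.concentrationConst m * (T - a)) a T hH
        haT (fun n ↦ Q (ψ n)) (fun n ↦ hQH (ψ n)) (fun n ↦ hQI (ψ n)) (fun n ↦ hQV (ψ n))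
        (fun n ↦ hQc (ψ n)) ε hε
  -- Step 2 (completeness): the `H_m`-concentrated limit of the fast Cauchy subsequence
  obtain ⟨P, hPH, -, hPT⟩ := hCP (MetricFlow.concentrationConst m) a T hH haT (fun n ↦ Q (σ n))
    (fun n ↦ hQH (σ n)) (fun n ↦ hQM (σ n)) hfast
  exact ⟨σ, hσ, P, hPH, hPT⟩

end Literature.Geometry.Riemannian

end
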